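import Summits.QuantumFields.BalabanUV.Beta.GAN24.DirichletBoxCompression
import Summits.QuantumFields.BalabanUV.Beta.GAN24.DirichletBoxTrace
import Summits.QuantumFields.BalabanUV.T4Continuum.Support.RegionGaugeProjection

/-!
# T⁴ programme, spine node NE2 (U1a), sub-row Δ1 «NE2⁰-Dirichlet» — THE COMPRESSIONS `Q′G′(Ω₀)Q′*` AND `Q′G′(Ω₀)²Q′*` OF THE
# REGION's `U = 1` SCALAR DIRICHLET PROPAGATOR ARE COERCIVE ON THE REGION's UNIT BLOCKS, UNIFORMLY IN `η` AND IN THE REGION: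
# `Q′_ΩG′_ΩQ′_Ω* ≥ σ₀`, `Q′_ΩG′_Ω²Q′_Ω* ≥ σ₀²`, `‖(Q′_ΩG′_Ω²Q′_Ω*)⁻¹‖ ≤ σ₀⁻²`, `σ₀ = (36^d·(4d + a′))⁻¹` — the (3.48)-shape bound
# of [B9] for ONE region at `U = 1`, level-free

NE2 formalisation swarm `b2b-balaban-t4-ne2-formalise-*`, leaf 07 (gen 5), supplier item «Δ1-COERC» under the owner's sub-row
`T4-U1a.S-NE2-D1-DIRICHLET°` (owner rulings R21 (e) / R22 (c): the [B9]-faithful vector region operator (3.26) is built from the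
REGION's gauge projection `R(Ω₀)` of (3.25), whose existence needs `Q′G′²Q′*` invertible — «positivity of Δ′_a … implies positivity of
the operators G′, Q′G′²Q′*, hence the existence of the operator R», [Balaban1985BackgroundPropagators] p. 395 — and whose USE needs a
bound on the inverse; Theorem 3.2 (3.48) p. 398 prints «|(Q′(U)G′²(U)Q′*(U))⁻¹(y, y′)| ≤ B₀(L^jη)^{−4} exp(−δ…)» for the multi-region,
background-dependent operator).

WHAT THIS FILE PROVES (model level: `U = 1`, ONE region `Ω = blockReg n M S` = the fine sites of a set `S` of unit blocks, ONE averaging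
scale; finite torus `T_{1/n}`, `η = 1/n`).  With road P2's compressed scalar operator `DOm n M a′ Ω = (Δ′)_{ΩΩ}` (`Δ′ = −Δ + a′Π′`,
[B9] (3.24) at `U = 1`: «Δ′_a↾Ω₀ = Ω₀Δ′_aΩ₀ … Its inverse is denoted by G′»), its inverse `GOm`, and the region rows of Bałaban's
scalar block averaging `QOm := (Q′)_{SΩ}`:
 * §1 the abstract VARIATIONAL BOUND `2re⟨g, h⟩ − re⟨g, Dg⟩ ≤ re⟨h, D⁻¹h⟩` for a Hermitian `D` with nonnegative form (`variational_abs`;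
   leaf-09's `ScalarAveragedCompression.variational` for arbitrary data);
 * §2 the objects `QOm`, `GOm`, `ScompR = n^d•(Q′_ΩG′_ΩQ′_Ωᴴ)` (= `Q′G′Q′*` with `Q′* = n^dQ′ᴴ`), `KcompR = n^d•(Q′_ΩG′_Ω²Q′_Ωᴴ)`, and the
   REGION TRIAL FUNCTION: leaf-09's in-block trial function `ScalarBlockTrialFunction.trial` of the zero-extended `φ` is BLOCK-LOCAL, hence
   vanishes off `Ω` and is Dirichlet-admissible for EVERY union of unit blocks (`trial_ext_apply_of_not`), with `Q′_Ωψ = β₁^d·φ`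
   (`QOm_trialR`) and `re⟨ψ, D^Ωψ⟩ ≤ (4d + a′)n^d·nsq φ` (`form_DOm_trialR_le`);
 * §3 **`form_ScompR_ge`**: `σ₀·nsq φ ≤ re⟨φ, S_Ωφ⟩` with leaf-09's TORUS constant `σ₀ = sigma0 d a′` — uniform in `n`, `M` AND `S`;
 * §4 **`form_KcompR_ge`** `σ₀²·nsq φ ≤ re⟨φ, K_Ωφ⟩`, `KcompR_posDef`, `isUnit_det_KcompR`, **`opNorm_KcompR_inv_le`** `‖K_Ω⁻¹‖ ≤ σ₀⁻²`;
 * §5 THE LINK TO THE OWNER's (3.25) ALGEBRA: `KcompR = n^d • gramK GOm QOm`, hence `IsUnit (gramK GOm QOm).det` («existence of R(Ω₀)»)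
   and **`opNorm_inv_gramK_region_le`** `‖(gramK GOm QOm)⁻¹‖ ≤ n^d·σ₀⁻²` — versus `RegionGaugeProjection.opNorm_inv_gramK_le`'s
   `‖Δ′‖²/c = n^d·‖Δ′‖² ∼ n^{d+4}`: the `η⁻⁴` of the crude bound is gone (the `n^d` is the normalisation `Q′Q′ᴴ = n^{−d}`; in Bałaban's
   normalisation `K_Ω = Q′G′²Q′*` the bound is level-free).  The projection `gaugeP GOm QOm` is insensitive to the normalisation.

HONEST FRAMING (T4-DAG p. 1).  [folklore] finite-dimensional variational/positivity arguments on the cell's typed `U = 1` objects;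
statements / constants OURS; nothing printed is a hypothesis; the printed (3.48) (kernel decay, multi-region, background field) is NOT
proved — only its diagonal, single-region, `U = 1` operator-norm shape.  NOT the coercivity of the vector operator (3.26) on a region
(OPEN: `Support/RegionGaugeSlice` isolates it as slice coercivity); NOT [B9] (3.23)–(3.27) as printed; NE2 (U1a) NOT proved; spine 0/9
unchanged; NOT infinite volume / mass gap / Clay / summit progress.  HONEST DEPENDENCY: continuum YM on T⁴ ⇐ BetaPertH ∧ nine spine
estimates (0/9 proved); BetaPertH ⇐ (D1) ∧ (D4) ∧ CAP+tail; G-an2-4 gates asym, D1 and NE2/3/4.  No `sorry`.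
-/

noncomputable section

open scoped BigOperators ComplexConjugate ComplexOrder Matrix Matrix.Norms.L2Operator
open Finset

namespace Summit.QuantumFields.BalabanUV.T4Continuum.RegionScalarCompression

open Literature.MathematicalPhysics.QuantumFieldTheory.Balaban1983to89.B5Prop11Plancherel (Tor fine opNorm_le_of_sq_le)
open Literature.MathematicalPhysics.QuantumFieldTheory.Balaban1983to89.B5Prop11Lower (nsq nsq_nonneg star_dotProduct_self
  norm_star_dotProduct_le nsq_mulVec_le)
open Literature.MathematicalPhysics.QuantumFieldTheory.Balaban1983to89.B5Action121 (star_mulVec_dotProduct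
  dotProduct_mulVec_eq_star_conjTranspose_mulVec)
open Literature.MathematicalPhysics.QuantumFieldTheory.Balaban1983to89.B5Block118 (QsOp)
open Literature.MathematicalPhysics.QuantumFieldTheory.Balaban1983to89.B5Blocks16 (blockOf)
open Summit.QuantumFields.BalabanUV.T4Continuum
open Summit.QuantumFields.BalabanUV.T4Continuum.SubtypeCompression (Coercive isUnit_det_of_coercive opNorm_inv_le_of_coercive
  ext ext_apply_of ext_apply_of_not nsq_ext star_ext_dotProduct toBlock_mulVec form_toBlock)
open Summit.QuantumFields.BalabanUV.T4Continuum.ScalarBlockPoincare (PiS nsq_PiS_mulVec_le nsq_PiS_mulVec_eq nsq_add_le nsq_smul)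
open Summit.QuantumFields.BalabanUV.T4Continuum.ScalarAveragedPropagator (DeltaPs gammaPs gammaPs_pos re_form_DeltaPs re_form_DeltaPs_ge
  DeltaPs_isHermitian re_star_dotProduct_le opNorm_le_of_nsq_le_rect)
open Summit.QuantumFields.BalabanUV.T4Continuum.ScalarBlockTrialFunction (trial beta1 beta1_ge QsOp_trial nsq_trial_le dirichlet_trial_le)
open Summit.QuantumFields.BalabanUV.T4Continuum.ScalarAveragedCompression (sigma0 sigma0_pos)
open Summit.QuantumFields.BalabanUV.T4Continuum.RegionGaugeProjection (gramK gaugeP)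
open Summit.QuantumFields.BalabanUV.Beta.GAN24.DirichletBoxCompression (DOm isUnit_det_DOm opNorm_inv_DOm_le DOm_isHermitian
  inv_DOm_isHermitian coercive_DeltaPs toBlock_mulVec')
open Summit.QuantumFields.BalabanUV.Beta.GAN24.DirichletBoxTrace (blockReg)

variable {d : ℕ}

/-! ## §1 The abstract variational bound -/

section Variational

variable {m : Type*} [Fintype m] [DecidableEq m]

/-- **VARIATIONAL BOUND for abstract data**: if `D` is Hermitian with `0 ≤ re⟨x, Dx⟩` for all `x` and `D·G = 1`, then
`2re⟨g, h⟩ − re⟨g, Dg⟩ ≤ re⟨h, Gh⟩` for all `g, h` (expand `0 ≤ re⟨g − Gh, D(g − Gh)⟩`). [folklore] -/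
theorem variational_abs {D G : Matrix m m ℂ} (hD : D.IsHermitian) (hpos : ∀ x : m → ℂ, 0 ≤ (star x ⬝ᵥ (D *ᵥ x)).re)
    (hDG : D * G = 1) (g h : m → ℂ) :
    2 * (star g ⬝ᵥ h).re - (star g ⬝ᵥ (D *ᵥ g)).re ≤ (star h ⬝ᵥ (G *ᵥ h)).re := by
  set x := G *ᵥ h with hx
  have hDx : D *ᵥ x = h := by rw [hx, Matrix.mulVec_mulVec, hDG, Matrix.one_mulVec]
  have h0 := hpos (g - x)
  -- expand the form of `g − x`
  have e : star (g - x) ⬝ᵥ (D *ᵥ (g - x)) = star g ⬝ᵥ (D *ᵥ g) - star g ⬝ᵥ h - star x ⬝ᵥ (D *ᵥ g) + star x ⬝ᵥ h := by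
    rw [Matrix.mulVec_sub, hDx, star_sub, sub_dotProduct, dotProduct_sub, dotProduct_sub]; ring
  -- `re⟨x, Dg⟩ = re⟨Dx, g⟩ = re⟨h, g⟩ = re⟨g, h⟩`
  have e2 : (star x ⬝ᵥ (D *ᵥ g)).re = (star g ⬝ᵥ h).re := by
    rw [dotProduct_mulVec_eq_star_conjTranspose_mulVec, hD.eq, hDx]
    have : star h ⬝ᵥ g = star (star g ⬝ᵥ h) := by rw [Matrix.star_dotProduct]
    rw [this, Complex.star_def, Complex.conj_re]
  -- `re⟨x, h⟩ = re⟨h, Gh⟩`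
  have e3 : (star x ⬝ᵥ h).re = (star h ⬝ᵥ (G *ᵥ h)).re := by
    have : star x ⬝ᵥ h = star (star h ⬝ᵥ x) := by rw [Matrix.star_dotProduct]
    rw [this, Complex.star_def, Complex.conj_re]
  rw [e] at h0
  simp only [Complex.sub_re, Complex.add_re] at h0
  linarith

end Variational

/-! ## §2 The region objects and the region trial function -/

section Region

variable (n : ℕ) [NeZero n] (M : Fin d → ℕ) [hM : ∀ μ, NeZero (M μ)] (a' : ℝ) (S : Tor M → Prop) [DecidablePred S]

/-- the REGION ROWS of Bałaban's scalar block averaging: `Q′_Ω = (Q′)_{SΩ}`, blocks in `S` × fine sites in `Ω = blockReg S`.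
[cite: Balaban1985BackgroundPropagators, (3.18)/(3.25) p.393 (shape)] [folklore] -/
def QOm : Matrix {y // S y} {x // blockReg n M S x} ℂ := (QsOp n M).toBlock S (blockReg n M S)

/-- the region's scalar Dirichlet propagator `G′(Ω) = ((Δ′)_{ΩΩ})⁻¹` (road P2's `DOm` inverted). [cite: Balaban1985BackgroundPropagators, (3.24) p.394 (shape)] [folklore] -/
def GOm : Matrix {x // blockReg n M S x} {x // blockReg n M S x} ℂ := (DOm n M a' (blockReg n M S))⁻¹

/-- `S_Ω = n^d•(Q′_ΩG′_ΩQ′_Ωᴴ)` = Bałaban's `Q′G′Q′*` on the region (`Q′* = n^dQ′ᴴ`). [folklore] -/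
def ScompR : Matrix {y // S y} {y // S y} ℂ := ((n : ℂ) ^ d) • (QOm n M S * GOm n M a' S * (QOm n M S)ᴴ)

/-- `K_Ω = n^d•(Q′_ΩG′_Ω²Q′_Ωᴴ)` = Bałaban's `Q′G′²Q′*` on the region. [cite: Balaban1985BackgroundPropagators, (3.25) p.394 (shape)] [folklore] -/
def KcompR : Matrix {y // S y} {y // S y} ℂ := ((n : ℂ) ^ d) • (QOm n M S * GOm n M a' S * GOm n M a' S * (QOm n M S)ᴴ)

/-- the REGION TRIAL FUNCTION: leaf-09's in-block trial function of the zero-extended `φ`, read on `Ω`. [folklore] -/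
def trialR (φ : {y // S y} → ℂ) : {x // blockReg n M S x} → ℂ := fun a => trial n M (ext S φ) a

/-- the torus trial function of the zero-extended `φ` VANISHES OFF THE REGION (it is block-local). [folklore] -/
theorem trial_ext_apply_of_not (φ : {y // S y} → ℂ) {x : Tor (fine n M)} (hx : ¬ blockReg n M S x) :
    trial n M (ext S φ) x = 0 := by
  unfold trial
  rw [ext_apply_of_not S φ (show ¬ S (blockOf n M x) from hx), zero_mul]

/-- hence extending the region trial function by zero gives back the torus trial function. [folklore] -/
theorem ext_trialR (φ : {y // S y} → ℂ) : ext (blockReg n M S) (trialR n M S φ) = trial n M (ext S φ) := by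
  funext x
  by_cases hx : blockReg n M S x
  · exact ext_apply_of (blockReg n M S) (trialR n M S φ) ⟨x, hx⟩
  · rw [ext_apply_of_not _ _ hx, trial_ext_apply_of_not n M S φ hx]

/-- **`Q′_Ωψ_φ = β₁^d·φ`**. [folklore] -/
theorem QOm_trialR (φ : {y // S y} → ℂ) : QOm n M S *ᵥ trialR n M S φ = (((beta1 n) ^ d : ℝ) : ℂ) • φ := by
  unfold QOm
  rw [toBlock_mulVec', ext_trialR, QsOp_trial]
  funext y
  rw [Pi.smul_apply, Pi.smul_apply, ext_apply_of]

/-- `D^Ω·G′_Ω = 1`. [folklore] -/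
theorem DOm_mul_GOm (ha' : 0 < a') : DOm n M a' (blockReg n M S) * GOm n M a' S = 1 :=
  Matrix.mul_nonsing_inv _ (isUnit_det_DOm n M a' (blockReg n M S) ha')

/-- `G′_Ω·D^Ω = 1`. [folklore] -/
theorem GOm_mul_DOm (ha' : 0 < a') : GOm n M a' S * DOm n M a' (blockReg n M S) = 1 :=
  Matrix.nonsing_inv_mul _ (isUnit_det_DOm n M a' (blockReg n M S) ha')

/-- `G′_Ω` is Hermitian. [folklore] -/
theorem GOm_isHermitian : (GOm n M a' S).IsHermitian := inv_DOm_isHermitian n M a' (blockReg n M S)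

/-- the form of `D^Ω` is nonnegative (indeed `≥ γ′`). [folklore] -/
theorem re_form_DOm_nonneg (ha' : 0 < a') (x : {x // blockReg n M S x} → ℂ) :
    0 ≤ (star x ⬝ᵥ (DOm n M a' (blockReg n M S) *ᵥ x)).re := by
  have h := SubtypeCompression.coercive_toBlock (blockReg n M S) (coercive_DeltaPs n M a' ha') x
  have hγ := (gammaPs_pos (d := d) (a' := a')).1
  have := nsq_nonneg x
  unfold DOm
  nlinarith

/-- **`re⟨ψ_φ, D^Ωψ_φ⟩ ≤ (4d + a′)·n^d·nsq φ`** (the torus energy of leaf-09's trial function, read through the compression).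
[folklore] -/
theorem form_DOm_trialR_le (ha' : 0 < a') (φ : {y // S y} → ℂ) :
    (star (trialR n M S φ) ⬝ᵥ (DOm n M a' (blockReg n M S) *ᵥ trialR n M S φ)).re ≤ (4 * d + a') * (n : ℝ) ^ d * nsq φ := by
  unfold DOm
  rw [form_toBlock, ext_trialR, re_form_DeltaPs]
  have h1 := dirichlet_trial_le n M (ext S φ)
  have h2 : nsq (PiS n M *ᵥ trial n M (ext S φ)) ≤ (n : ℝ) ^ d * nsq (ext S φ) :=
    (nsq_PiS_mulVec_le n M _).trans (nsq_trial_le n M (ext S φ))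
  rw [nsq_ext] at h1 h2
  nlinarith [ha'.le]

/-- `⟨φ, S_Ωφ⟩ = n^d·⟨Q′_Ωᴴφ, G′_ΩQ′_Ωᴴφ⟩`. [folklore] -/
theorem form_ScompR (φ : {y // S y} → ℂ) :
    star φ ⬝ᵥ (ScompR n M a' S *ᵥ φ)
      = ((n : ℂ) ^ d) * (star ((QOm n M S)ᴴ *ᵥ φ) ⬝ᵥ (GOm n M a' S *ᵥ ((QOm n M S)ᴴ *ᵥ φ))) := by
  rw [ScompR, Matrix.smul_mulVec, dotProduct_smul, smul_eq_mul, ← Matrix.mulVec_mulVec, ← Matrix.mulVec_mulVec]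
  congr 1
  rw [star_mulVec_dotProduct, Matrix.conjTranspose_conjTranspose]

/-! ## §3 `S_Ω = Q′_ΩG′_ΩQ′_Ω*` is coercive, uniformly in `η` and in the region -/

/-- **`S_Ω ≥ σ₀` UNIFORMLY IN `n`, `M` AND THE REGION**: `σ₀·nsq φ ≤ re⟨φ, S_Ωφ⟩`, `σ₀ = (36^d(4d + a′))⁻¹` (leaf-09's torus constant).
[cite: Balaban1985BackgroundPropagators, p.395 (positivity of Q′G′²Q′*) (shape)] [folklore] -/
theorem form_ScompR_ge (ha' : 0 < a') (φ : {y // S y} → ℂ) : sigma0 d a' * nsq φ ≤ (star φ ⬝ᵥ (ScompR n M a' S *ᵥ φ)).re := by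
  have hn : (0 : ℝ) < (n : ℝ) ^ d := pow_pos (by exact_mod_cast Nat.pos_of_ne_zero (NeZero.ne n)) d
  set β : ℝ := (beta1 n) ^ d with hβ
  have hβ0 : 0 < β := pow_pos (beta1_ge n).2 d
  have hβ6 : (1 / 6 : ℝ) ^ d ≤ β := pow_le_pow_left₀ (by norm_num) (beta1_ge n).1 d
  set c : ℝ := (4 * d + a') * (n : ℝ) ^ d with hc
  have hc0 : 0 < c := by positivity
  set h := (QOm n M S)ᴴ *ᵥ φ with hh
  set ψ := trialR n M S φ with hψ
  -- `re⟨ψ, h⟩ = β·nsq φ`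
  have e1 : (star ψ ⬝ᵥ h).re = β * nsq φ := by
    rw [hh, ← star_mulVec_dotProduct, hψ, QOm_trialR, star_smul, smul_dotProduct, star_dotProduct_self, smul_eq_mul]
    rw [← hβ]
    simp [Complex.conj_ofReal]
  -- `re⟨ψ, D^Ωψ⟩ ≤ c·nsq φ`
  have e2 : (star ψ ⬝ᵥ (DOm n M a' (blockReg n M S) *ᵥ ψ)).re ≤ c * nsq φ := by
    rw [hc]; exact form_DOm_trialR_le n M a' S ha' φ
  -- the variational bound at `g = t•ψ`, `t = β/c`
  set t : ℝ := β / c with ht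
  have hv := variational_abs (DOm_isHermitian n M a' (blockReg n M S)) (re_form_DOm_nonneg n M a' S ha')
    (DOm_mul_GOm n M a' S ha') ((t : ℂ) • ψ) h
  have e3 : (star ((t : ℂ) • ψ) ⬝ᵥ h).re = t * (β * nsq φ) := by
    rw [star_smul, smul_dotProduct, smul_eq_mul, Complex.star_def, Complex.conj_ofReal, Complex.re_ofReal_mul, e1]
  have e4 : (star ((t : ℂ) • ψ) ⬝ᵥ (DOm n M a' (blockReg n M S) *ᵥ ((t : ℂ) • ψ))).re
      = t ^ 2 * (star ψ ⬝ᵥ (DOm n M a' (blockReg n M S) *ᵥ ψ)).re := by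
    rw [Matrix.mulVec_smul, star_smul, smul_dotProduct, dotProduct_smul, smul_eq_mul, smul_eq_mul, Complex.star_def,
      Complex.conj_ofReal, ← mul_assoc, ← Complex.ofReal_mul, Complex.re_ofReal_mul, sq]
  rw [e3, e4] at hv
  -- `⟨φ,S_Ωφ⟩ = n^d ⟨h, G′h⟩`
  have e5 : (star φ ⬝ᵥ (ScompR n M a' S *ᵥ φ)).re = (n : ℝ) ^ d * (star h ⬝ᵥ (GOm n M a' S *ᵥ h)).re := by
    rw [form_ScompR, ← hh, ← Complex.ofReal_natCast, ← Complex.ofReal_pow, Complex.re_ofReal_mul]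
  rw [e5]
  have hda0 : (4 * (d : ℝ) + a') ≠ 0 := by positivity
  have hnd0 : ((n : ℝ) ^ d) ≠ 0 := hn.ne'
  have hcne : c ≠ 0 := hc0.ne'
  have k1 : 2 * (t * (β * nsq φ)) - t ^ 2 * (c * nsq φ) = β ^ 2 / c * nsq φ := by
    rw [ht]; field_simp; ring
  have k2 : (n : ℝ) ^ d * (β ^ 2 / c * nsq φ) = β ^ 2 / (4 * d + a') * nsq φ := by
    rw [hc, div_mul_eq_mul_div, div_mul_eq_mul_div, mul_div_assoc', div_eq_div_iff (mul_ne_zero hda0 hnd0) hda0]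
    ring
  have key : (n : ℝ) ^ d * (2 * (t * (β * nsq φ)) - t ^ 2 * (c * nsq φ)) = β ^ 2 / (4 * d + a') * nsq φ := by
    rw [k1, k2]
  have step : β ^ 2 / (4 * d + a') * nsq φ ≤ (n : ℝ) ^ d * (star h ⬝ᵥ (GOm n M a' S *ᵥ h)).re := by
    rw [← key]
    refine mul_le_mul_of_nonneg_left ?_ hn.le
    have : t ^ 2 * (star ψ ⬝ᵥ (DOm n M a' (blockReg n M S) *ᵥ ψ)).re ≤ t ^ 2 * (c * nsq φ) :=
      mul_le_mul_of_nonneg_left e2 (sq_nonneg t)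
    linarith
  refine le_trans ?_ step
  refine mul_le_mul_of_nonneg_right ?_ (nsq_nonneg φ)
  -- `σ₀ ≤ β²/(4d + a′)`
  have h36 : ((36 : ℝ) ^ d)⁻¹ = ((1 / 6 : ℝ) ^ d) ^ 2 := by
    rw [← inv_pow, ← pow_mul, mul_comm, pow_mul, show ((1 / 6 : ℝ)) ^ 2 = 36⁻¹ by norm_num]
  have hda : (0 : ℝ) < 4 * d + a' := by positivity
  unfold sigma0
  rw [mul_inv, h36, ← div_eq_mul_inv]
  exact div_le_div_of_nonneg_right (pow_le_pow_left₀ (by positivity) hβ6 2) hda.le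

/-! ## §4 `K_Ω = Q′_ΩG′_Ω²Q′_Ω* ≥ S_Ω² ≥ σ₀²`, and `‖K_Ω⁻¹‖ ≤ σ₀⁻²` -/

/-- `K_Ω` is Hermitian. [folklore] -/
theorem KcompR_isHermitian : (KcompR n M a' S).IsHermitian := by
  have hG := GOm_isHermitian n M a' S
  unfold Matrix.IsHermitian KcompR
  rw [Matrix.conjTranspose_smul, Matrix.conjTranspose_mul, Matrix.conjTranspose_mul, Matrix.conjTranspose_mul,
    Matrix.conjTranspose_conjTranspose, hG.eq, ← Matrix.mul_assoc, ← Matrix.mul_assoc]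
  congr 1
  rw [Complex.star_def, ← Complex.ofReal_natCast, ← Complex.ofReal_pow, Complex.conj_ofReal]

/-- `⟨φ, K_Ωφ⟩ = n^d·nsq (G′_ΩQ′_Ωᴴφ)`. [folklore] -/
theorem form_KcompR_eq (φ : {y // S y} → ℂ) :
    star φ ⬝ᵥ (KcompR n M a' S *ᵥ φ) = (((n : ℝ) ^ d * nsq (GOm n M a' S *ᵥ ((QOm n M S)ᴴ *ᵥ φ)) : ℝ) : ℂ) := by
  have hG := GOm_isHermitian n M a' S
  set u := GOm n M a' S *ᵥ ((QOm n M S)ᴴ *ᵥ φ) with hu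
  rw [KcompR, Matrix.smul_mulVec, dotProduct_smul, smul_eq_mul, ← Matrix.mulVec_mulVec, ← Matrix.mulVec_mulVec,
    ← Matrix.mulVec_mulVec, ← hu]
  have e1 : star φ ⬝ᵥ (QOm n M S *ᵥ (GOm n M a' S *ᵥ u)) = star ((QOm n M S)ᴴ *ᵥ φ) ⬝ᵥ (GOm n M a' S *ᵥ u) := by
    rw [star_mulVec_dotProduct, Matrix.conjTranspose_conjTranspose]
  have e2 : star ((QOm n M S)ᴴ *ᵥ φ) ⬝ᵥ (GOm n M a' S *ᵥ u) = star u ⬝ᵥ u := by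
    conv_rhs => rw [hu, star_mulVec_dotProduct, hG.eq]
  rw [e1, e2, star_dotProduct_self]; push_cast; ring

omit [NeZero n] [DecidablePred S] in
/-- restricting a unit-lattice field to a subset of blocks does not increase `nsq`. [folklore] -/
theorem nsq_restrict_le {p : Tor M → Prop} [DecidablePred p] (v : Tor M → ℂ) : nsq (fun a : {y // p y} => v a) ≤ nsq v := by
  classical
  unfold nsq
  rw [← Fintype.sum_subtype_add_sum_subtype p (fun i => ‖v i‖ ^ 2)]
  have h2 : 0 ≤ ∑ i : {i // ¬ p i}, ‖v i‖ ^ 2 := Finset.sum_nonneg fun i _ => sq_nonneg _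
  linarith

/-- `n^d·nsq (Q′_Ω u) ≤ nsq u` (`Π′ ≤ 1`, through the compression). [folklore] -/
theorem nsq_QOm_mulVec_le (u : {x // blockReg n M S x} → ℂ) : (n : ℝ) ^ d * nsq (QOm n M S *ᵥ u) ≤ nsq u := by
  unfold QOm
  rw [toBlock_mulVec']
  have h1 : nsq (fun a : {y // S y} => (QsOp n M *ᵥ ext (blockReg n M S) u) a) ≤ nsq (QsOp n M *ᵥ ext (blockReg n M S) u) :=
    nsq_restrict_le M _
  have h2 : (n : ℝ) ^ d * nsq (QsOp n M *ᵥ ext (blockReg n M S) u) ≤ nsq u := by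
    rw [← nsq_PiS_mulVec_eq, ← nsq_ext (blockReg n M S) u]
    exact nsq_PiS_mulVec_le n M _
  have hn : (0 : ℝ) ≤ (n : ℝ) ^ d := pow_nonneg (Nat.cast_nonneg _) d
  nlinarith

/-- **`⟨φ, K_Ωφ⟩ ≥ nsq (S_Ωφ)`**. [folklore] -/
theorem nsq_ScompR_le_form_KcompR (φ : {y // S y} → ℂ) : nsq (ScompR n M a' S *ᵥ φ) ≤ (star φ ⬝ᵥ (KcompR n M a' S *ᵥ φ)).re := by
  have hn : (0 : ℝ) ≤ (n : ℝ) ^ d := pow_nonneg (Nat.cast_nonneg _) d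
  set u := GOm n M a' S *ᵥ ((QOm n M S)ᴴ *ᵥ φ) with hu
  have e2 : ScompR n M a' S *ᵥ φ = ((n : ℂ) ^ d) • (QOm n M S *ᵥ u) := by
    rw [ScompR, Matrix.smul_mulVec, ← Matrix.mulVec_mulVec, ← Matrix.mulVec_mulVec, ← hu]
  have e3 : nsq (ScompR n M a' S *ᵥ φ) = (n : ℝ) ^ d * ((n : ℝ) ^ d * nsq (QOm n M S *ᵥ u)) := by
    rw [e2, nsq_smul, norm_pow, Complex.norm_natCast]; ring
  rw [form_KcompR_eq, e3, Complex.ofReal_re]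
  exact mul_le_mul_of_nonneg_left (nsq_QOm_mulVec_le n M S u) hn

/-- **`K_Ω ≥ σ₀²` UNIFORMLY IN `n`, `M` AND THE REGION**. [cite: Balaban1985BackgroundPropagators, Thm 3.2 (3.48) p.398 (shape: diagonal, U = 1, one region)] [folklore] -/
theorem form_KcompR_ge (ha' : 0 < a') (φ : {y // S y} → ℂ) : (sigma0 d a') ^ 2 * nsq φ ≤ (star φ ⬝ᵥ (KcompR n M a' S *ᵥ φ)).re := by
  refine le_trans ?_ (nsq_ScompR_le_form_KcompR n M a' S φ)
  have h1 : sigma0 d a' * nsq φ ≤ Real.sqrt (nsq φ) * Real.sqrt (nsq (ScompR n M a' S *ᵥ φ)) :=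
    (form_ScompR_ge n M a' S ha' φ).trans (re_star_dotProduct_le _ _)
  have hsφ : Real.sqrt (nsq φ) ^ 2 = nsq φ := Real.sq_sqrt (nsq_nonneg _)
  have hsS : Real.sqrt (nsq (ScompR n M a' S *ᵥ φ)) ^ 2 = nsq (ScompR n M a' S *ᵥ φ) := Real.sq_sqrt (nsq_nonneg _)
  by_cases hz : nsq φ = 0
  · rw [hz, mul_zero]; exact nsq_nonneg _
  · have hpos : 0 < nsq φ := lt_of_le_of_ne (nsq_nonneg _) (Ne.symm hz)
    have hsq0 : 0 < Real.sqrt (nsq φ) := Real.sqrt_pos.mpr hpos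
    have h2 : sigma0 d a' * Real.sqrt (nsq φ) ≤ Real.sqrt (nsq (ScompR n M a' S *ᵥ φ)) := by
      have h3 : sigma0 d a' * Real.sqrt (nsq φ) * Real.sqrt (nsq φ)
          ≤ Real.sqrt (nsq (ScompR n M a' S *ᵥ φ)) * Real.sqrt (nsq φ) := by
        rw [mul_assoc, ← sq, hsφ, mul_comm (Real.sqrt _)]; exact h1
      exact le_of_mul_le_mul_right h3 hsq0
    calc sigma0 d a' ^ 2 * nsq φ = (sigma0 d a' * Real.sqrt (nsq φ)) ^ 2 := by rw [mul_pow, hsφ]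
      _ ≤ Real.sqrt (nsq (ScompR n M a' S *ᵥ φ)) ^ 2 :=
          pow_le_pow_left₀ (mul_nonneg (sigma0_pos (d := d) ha').le (Real.sqrt_nonneg _)) h2 2
      _ = nsq (ScompR n M a' S *ᵥ φ) := hsS

/-- `K_Ω` is `σ₀²`-coercive (the owner's `Coercive` predicate). [folklore] -/
theorem coercive_KcompR (ha' : 0 < a') : Coercive (KcompR n M a' S) ((sigma0 d a') ^ 2) :=
  fun φ => form_KcompR_ge n M a' S ha' φ

/-- `K_Ω` is invertible («hence the existence of the operator R», for the region). [cite: Balaban1985BackgroundPropagators, p.395 (shape)] [folklore] -/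
theorem isUnit_det_KcompR (ha' : 0 < a') : IsUnit (KcompR n M a' S).det :=
  isUnit_det_of_coercive (pow_pos (sigma0_pos (d := d) ha') 2) (coercive_KcompR n M a' S ha')

/-- **`‖K_Ω⁻¹‖ ≤ σ₀⁻²` — UNIFORM in `η = 1/n`, in the torus AND in the region `S`.**
[cite: Balaban1985BackgroundPropagators, Thm 3.2 (3.48) p.398 (shape: diagonal, U = 1, one region)] [folklore] -/
theorem opNorm_KcompR_inv_le (ha' : 0 < a') : ‖(KcompR n M a' S)⁻¹‖ ≤ ((sigma0 d a') ^ 2)⁻¹ :=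
  opNorm_inv_le_of_coercive (pow_pos (sigma0_pos (d := d) ha') 2) (coercive_KcompR n M a' S ha')

/-! ## §5 The link to the owner's (3.25) algebra `gramK` / `gaugeP` -/

/-- `K_Ω = n^d • gramK G′_Ω Q′_Ω`. [folklore] -/
theorem KcompR_eq_smul_gramK : KcompR n M a' S = ((n : ℂ) ^ d) • gramK (GOm n M a' S) (QOm n M S) := rfl

/-- hence `Q′_ΩG′_Ω²Q′_Ωᴴ` is invertible — the REGION instance of «existence of R» with NO appeal to `‖Δ′‖`. [cite: Balaban1985BackgroundPropagators, p.395 (shape)] [folklore] -/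
theorem isUnit_det_gramK_region (ha' : 0 < a') : IsUnit (gramK (GOm n M a' S) (QOm n M S)).det := by
  have hn : ((n : ℂ) ^ d) ≠ 0 := pow_ne_zero d (by exact_mod_cast NeZero.ne n)
  have h := isUnit_det_KcompR n M a' S ha'
  rw [KcompR_eq_smul_gramK, Matrix.det_smul] at h
  exact isUnit_of_mul_isUnit_right h

/-- `(gramK G′_Ω Q′_Ω)⁻¹ = n^d • K_Ω⁻¹`. [folklore] -/
theorem inv_gramK_region_eq (ha' : 0 < a') :
    (gramK (GOm n M a' S) (QOm n M S))⁻¹ = ((n : ℂ) ^ d) • (KcompR n M a' S)⁻¹ := by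
  have hn : ((n : ℂ) ^ d) ≠ 0 := pow_ne_zero d (by exact_mod_cast NeZero.ne n)
  refine Matrix.inv_eq_left_inv ?_
  rw [Matrix.smul_mul, ← Matrix.mul_smul, ← KcompR_eq_smul_gramK, Matrix.nonsing_inv_mul _ (isUnit_det_KcompR n M a' S ha')]

/-- **`‖(Q′_ΩG′_Ω²Q′_Ωᴴ)⁻¹‖ ≤ n^d·σ₀⁻²`** in the owner's normalisation (`Q′Q′ᴴ = n^{−d}·1`) — versus `RegionGaugeProjection.opNorm_inv_gramK_le`'s
`‖Δ′‖²·n^d ∼ n^{d+4}`; in Bałaban's normalisation (`KcompR`) the bound is level-free. [cite: Balaban1985BackgroundPropagators, Thm 3.2 (3.48) p.398 (shape)] [folklore] -/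
theorem opNorm_inv_gramK_region_le (ha' : 0 < a') :
    ‖(gramK (GOm n M a' S) (QOm n M S))⁻¹‖ ≤ (n : ℝ) ^ d * ((sigma0 d a') ^ 2)⁻¹ := by
  rw [inv_gramK_region_eq n M a' S ha', Matrix.l2_opNorm_def, map_smul, norm_smul, norm_pow, Complex.norm_natCast,
    ← Matrix.l2_opNorm_def]
  exact mul_le_mul_of_nonneg_left (opNorm_KcompR_inv_le n M a' S ha') (pow_nonneg (Nat.cast_nonneg _) d)

/-- CONSISTENCY (kernel): the region gauge projection of (3.25) built from these objects is the owner's `gaugeP GOm QOm`; it is the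
same for `Q′_Ω` and for Bałaban's `n^{d/2}`-normalised averaging (the scale cancels) — recorded here only as the definitional identity. -/
example : gaugeP (GOm n M a' S) (QOm n M S)
    = GOm n M a' S * (QOm n M S)ᴴ * (gramK (GOm n M a' S) (QOm n M S))⁻¹ * QOm n M S * GOm n M a' S := rfl

end Region

end Summit.QuantumFields.BalabanUV.T4Continuum.RegionScalarCompression

end
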